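import Mathlib.NumberTheory.Padics.PadicVal.Basic
import Mathlib.Tactic.Linarith
import Mathlib.Tactic.LinearCombination
import Mathlib.Tactic.Positivity
import Mathlib.Tactic.Ring
import HarnessLib

/-!
# Kramer's `2`-descent on `A : y² + xy = x³ + 8m x² + m(16m+1) x` — valuations and parities

K. Kramer, *A family of semistable elliptic curves with large Tate–Shafarevitch groups*,
Proc. Amer. Math. Soc. **89** (1983), 379–386 [Kramer1983]. For the curve `A` of §5 (11)
(`m` odd, `ℓ = 16m + 1`), the complete `2`-descent `λ : A(K)/2A(K) ↪ (K*/K*²)³`,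
`P = (x, y) ↦ (x + t₁, x + t₂, x + t₃)` with `t₁ = 0`, `t₂ = 4m`, `t₃ = ℓ/4` (§3 (4)–(6), §4:
`(y + x/2)² = x (x + 4m)(x + ℓ/4)`, `sq_eq_descentTriple`), has local images `S_p`
described by Lemma 2 (p. 381, from Brumer–Kramer): (i) `p ∤ 2Δ`: units × squares;
(ii) `p = 2`: units (with `ab ≡ 1 (4)`); (iii) `p ∣ m`: `(a, a, 1)`; (iv) `p ∣ ℓ`,
`b₂ ∈ ℚ_p²`: `(a, 1, a)`; (v) `∞`, `m > 0`: `(a, a, 1)`. The proof of the Theorem of §5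
(pp. 383–384) uses only the CONTAINMENTS `λ(A(ℚ)) ⊆ S_p` (necessity of the local
conditions).

This file proves the parity part of those containments for RATIONAL points, by elementary
valuation arguments with Mathlib's `padicValRat` (additive, junk value `v(0) = 0`, whence
the "`= 0 ∨`" disjunctions in the auxiliary lemmas):

* `padicValRat_add_eq_left`, `le_padicValRat_add_or`, `padicValRat_add_add_eq` — ultrametric
  bookkeeping;
* `even_padicValRat_of_neg` — for any integral Weierstrass equation, `v_p(x) < 0 ⇒ v_p(x)`
  even (`2 v(y) = 3 v(x)`; the classical `x = a/d²`);
* `padicValRat_two_x_ne_one`, `even_padicValRat_two` — Lemma 2 (ii): at `p = 2` all three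
  coordinates `x`, `x + 4m`, `x + ℓ/4` of a rational point have even valuation (replacing
  the formal-group argument of Brumer–Kramer by the observation that `v₂(x) = 1` is
  impossible on (11));
* `even_padicValRat_odd_good` — Lemma 2 (i): the same at odd `p ∤ mℓ` (the tree's
  `Valuation.two_dvd_log_map_sub_of_sq_eq`, file `TwoDescentParity`, is the abstract-valuation
  form of this statement; here the concrete `padicValRat` form is what the sequel consumes).

The square conditions of Lemma 2 (iii), (iv), the sign condition (v) and the translation
into Legendre symbols are in `KramerTwoDescentLocal.lean`; the resulting bound
`dim A(ℚ)/2A(ℚ) ≤ |𝔏| + |𝔐| + 1 - 2n` in `KramerTwoDescentBound.lean`.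

## References

* K. Kramer, Proc. Amer. Math. Soc. 89 (1983) 379–386, doi:10.1090/s0002-9939-1983-0715850-1:
  §3 (4)–(6), §4 Lemma 2 (p. 381), §5 (11) and the proof of the Theorem (pp. 383–384).
  [Kramer1983] (held, read in full).
* A. Brumer, K. Kramer, *The rank of elliptic curves*, Duke Math. J. 44 (1977) 715–743
  (Kramer's source [2] for Lemma 2; not used).
-/

namespace Literature.NumberTheory.EllipticCurves.KramerTwoDescent

open padicValRat

section Valuation

variable {p : ℕ} [Fact p.Prime]

/-- Ultrametric domination: if `v_p(a) < v_p(b)` (or `b = 0`) then `a + b ≠ 0` and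
`v_p(a + b) = v_p(a)`. [folklore] -/
theorem padicValRat_add_eq_left {a b : ℚ} (ha : a ≠ 0)
    (h : b = 0 ∨ padicValRat p a < padicValRat p b) :
    a + b ≠ 0 ∧ padicValRat p (a + b) = padicValRat p a := by
  by_cases hb : b = 0
  · subst hb; simpa using ha
  have hlt : padicValRat p a < padicValRat p b := h.resolve_left hb
  have hab : a + b ≠ 0 := by
    intro hab
    have hba : b = -a := by linear_combination hab
    rw [hba, padicValRat.neg] at hlt
    exact lt_irrefl _ hlt
  exact ⟨hab, padicValRat.add_eq_of_lt hab ha hb hlt⟩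

/-- A lower bound for the valuation of a sum that may vanish: if each of `a`, `b` is `0` or
has `v_p ≥ c`, then `a + b = 0` or `v_p(a + b) ≥ c`. [folklore] -/
theorem le_padicValRat_add_or {a b : ℚ} {c : ℤ} (ha : a = 0 ∨ c ≤ padicValRat p a)
    (hb : b = 0 ∨ c ≤ padicValRat p b) : a + b = 0 ∨ c ≤ padicValRat p (a + b) := by
  by_cases hab : a + b = 0
  · exact Or.inl hab
  refine Or.inr ?_
  by_cases ha0 : a = 0
  · subst ha0
    rw [zero_add] at hab ⊢
    exact hb.resolve_left hab
  by_cases hb0 : b = 0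
  · subst hb0
    rw [add_zero] at hab ⊢
    exact ha.resolve_left hab
  exact (le_min (ha.resolve_left ha0) (hb.resolve_left hb0)).trans
    (padicValRat.min_le_padicValRat_add hab)

/-- Three-term domination: if `v_p(a)` is smaller than the valuations of the non-zero ones
among `b`, `c`, then `a + b + c ≠ 0` and `v_p(a + b + c) = v_p(a)`. [folklore] -/
theorem padicValRat_add_add_eq {a b c : ℚ} (ha : a ≠ 0)
    (hb : b = 0 ∨ padicValRat p a < padicValRat p b)
    (hc : c = 0 ∨ padicValRat p a < padicValRat p c) :
    a + b + c ≠ 0 ∧ padicValRat p (a + b + c) = padicValRat p a := by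
  rw [add_assoc]
  refine padicValRat_add_eq_left ha ?_
  have hb' : b = 0 ∨ padicValRat p a + 1 ≤ padicValRat p b :=
    hb.imp_right fun h => Int.add_one_le_of_lt h
  have hc' : c = 0 ∨ padicValRat p a + 1 ≤ padicValRat p c :=
    hc.imp_right fun h => Int.add_one_le_of_lt h
  exact (le_padicValRat_add_or hb' hc').imp_right fun h => Int.lt_of_add_one_le h

omit [Fact p.Prime] in
/-- The valuation of an integer is non-negative (as a rational). [folklore] -/
theorem padicValRat_intCast_nonneg (z : ℤ) : 0 ≤ padicValRat p (z : ℚ) := by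
  rw [padicValRat.of_int]; exact Int.natCast_nonneg _

omit [Fact p.Prime] in
/-- An integer prime to `p` is a `p`-adic unit. [folklore] -/
theorem padicValRat_intCast_eq_zero {z : ℤ} (hz : ¬ (p : ℤ) ∣ z) : padicValRat p (z : ℚ) = 0 := by
  rw [padicValRat.of_int, padicValInt.eq_zero_of_not_dvd hz, Nat.cast_zero]

/-- An integer divisible by `p` is `0` or has valuation `≥ 1`. [folklore] -/
theorem padicValRat_intCast_of_dvd {z : ℤ} (hz : (p : ℤ) ∣ z) :
    (z : ℚ) = 0 ∨ 1 ≤ padicValRat p (z : ℚ) := by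
  by_cases h0 : z = 0
  · exact Or.inl (by rw [h0, Int.cast_zero])
  refine Or.inr ?_
  rw [padicValRat.of_int]
  have := ((padicValInt_dvd_iff 1 z).mp (by rwa [pow_one])).resolve_left h0
  exact_mod_cast this

end Valuation

section IntegralPoints

variable {p : ℕ} [Fact p.Prime]

/-- **Non-integral points have even pole order in `x`.** For a Weierstrass equation with
integral coefficients `y² + a₁xy + a₃y = x³ + a₂x² + a₄x + a₆` and a rational solution with
`v_p(x) < 0`, one has `2 v_p(y) = 3 v_p(x)`, so `v_p(x)` is even (the classical observation
behind `x = a/d²`, `y = b/d³`; Silverman AEC VII.3.1 / Kramer's use of `T_p ⊆` units for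
`p ∤ 2Δ`). [folklore] -/
theorem even_padicValRat_of_neg {a₁ a₂ a₃ a₄ a₆ : ℤ} {x y : ℚ}
    (h : y ^ 2 + a₁ * x * y + a₃ * y = x ^ 3 + a₂ * x ^ 2 + a₄ * x + a₆)
    (hx : padicValRat p x < 0) : Even (padicValRat p x) := by
  have hx0 : x ≠ 0 := by rintro rfl; simp at hx
  set v := padicValRat p x with hv
  -- the right-hand side is dominated by `x³`
  have hx3 : padicValRat p (x ^ 3) = 3 * v := by rw [padicValRat.pow, hv]; norm_num
  have hrest : (a₂ : ℚ) * x ^ 2 + ((a₄ : ℚ) * x + a₆) = 0 ∨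
      3 * v + 1 ≤ padicValRat p ((a₂ : ℚ) * x ^ 2 + ((a₄ : ℚ) * x + a₆)) := by
    refine le_padicValRat_add_or ?_ (le_padicValRat_add_or ?_ ?_)
    · by_cases h2 : (a₂ : ℚ) = 0
      · exact Or.inl (by rw [h2, zero_mul])
      · refine Or.inr ?_
        rw [padicValRat.mul h2 (pow_ne_zero 2 hx0), padicValRat.pow]
        have := padicValRat_intCast_nonneg (p := p) a₂
        omega
    · by_cases h4 : (a₄ : ℚ) = 0
      · exact Or.inl (by rw [h4, zero_mul])
      · refine Or.inr ?_
        rw [padicValRat.mul h4 hx0]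
        have := padicValRat_intCast_nonneg (p := p) a₄
        omega
    · by_cases h6 : (a₆ : ℚ) = 0
      · exact Or.inl h6
      · have := padicValRat_intCast_nonneg (p := p) a₆
        exact Or.inr (by omega)
  have hR : x ^ 3 + ((a₂ : ℚ) * x ^ 2 + ((a₄ : ℚ) * x + a₆)) ≠ 0 ∧
      padicValRat p (x ^ 3 + ((a₂ : ℚ) * x ^ 2 + ((a₄ : ℚ) * x + a₆))) = 3 * v := by
    rw [← hx3]
    exact padicValRat_add_eq_left (pow_ne_zero 3 hx0) (hrest.imp_right fun h' => by omega)
  have hRHS : x ^ 3 + (a₂ : ℚ) * x ^ 2 + (a₄ : ℚ) * x + a₆ =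
      x ^ 3 + ((a₂ : ℚ) * x ^ 2 + ((a₄ : ℚ) * x + a₆)) := by ring
  rw [hRHS] at h
  -- the left-hand side is `y (y + a₁ x + a₃)`
  have hLHS : y ^ 2 + (a₁ : ℚ) * x * y + a₃ * y = y * (y + ((a₁ : ℚ) * x + a₃)) := by ring
  rw [hLHS] at h
  have hy0 : y ≠ 0 := by
    rintro rfl
    rw [zero_mul] at h
    exact hR.1 h.symm
  have hyt0 : y + ((a₁ : ℚ) * x + a₃) ≠ 0 := by
    intro h0
    rw [h0, mul_zero] at h
    exact hR.1 h.symm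
  set w := padicValRat p y with hw
  have ht : (a₁ : ℚ) * x + a₃ = 0 ∨ v ≤ padicValRat p ((a₁ : ℚ) * x + a₃) := by
    refine le_padicValRat_add_or ?_ ?_
    · by_cases h1 : (a₁ : ℚ) = 0
      · exact Or.inl (by rw [h1, zero_mul])
      · refine Or.inr ?_
        rw [padicValRat.mul h1 hx0]
        have := padicValRat_intCast_nonneg (p := p) a₁
        omega
    · by_cases h3 : (a₃ : ℚ) = 0
      · exact Or.inl h3
      · have := padicValRat_intCast_nonneg (p := p) a₃
        exact Or.inr (by omega)
  have hval := congrArg (padicValRat p) h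
  rw [padicValRat.mul hy0 hyt0, hR.2] at hval
  by_cases hwv : w < v
  · have h1 := (padicValRat_add_eq_left (p := p) hy0 (ht.imp_right fun h' => by omega)).2
    rw [h1, ← hw] at hval
    exact ⟨w - v, by omega⟩
  · exfalso
    have h1 : v ≤ padicValRat p (y + ((a₁ : ℚ) * x + a₃)) :=
      (le_padicValRat_add_or (p := p) (Or.inr (by omega)) ht).resolve_left hyt0
    omega

/-- **No point of `A_m` has `v₂(x) = 1`** (`m`, `ℓ` odd): on
`y² + xy = x³ + 8m x² + mℓ x` the right-hand side would have `2`-adic valuation exactly `1`,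
while `y(y + x)` never has. This is the elementary input replacing the formal-group argument
of Brumer–Kramer, Lemma 3.5/Prop. 3.6, in Kramer's Lemma 2(ii) (`T₂ ⊆` units).
[cite: Kramer1983, Lemma 2 (ii)] -/
theorem padicValRat_two_x_ne_one {m l : ℤ} (hm : Odd m) (hl : Odd l) {x y : ℚ}
    (h : y ^ 2 + x * y = x ^ 3 + 8 * m * x ^ 2 + m * l * x) : padicValRat 2 x ≠ 1 := by
  intro hv
  have hx0 : x ≠ 0 := by rintro rfl; simp at hv
  have hml : ¬ (2 : ℤ) ∣ m * l := by
    rw [← even_iff_two_dvd, Int.even_mul, not_or]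
    exact ⟨Int.not_even_iff_odd.mpr hm, Int.not_even_iff_odd.mpr hl⟩
  have hml0 : ((m * l : ℤ) : ℚ) ≠ 0 := by
    have : m * l ≠ 0 := fun h0 => hml (h0 ▸ dvd_zero 2)
    exact_mod_cast this
  have hvml : padicValRat 2 ((m * l : ℤ) : ℚ) = 0 :=
    padicValRat_intCast_eq_zero (p := 2) (by exact_mod_cast hml)
  -- the right-hand side `mℓx + x³ + 8mx²` has valuation `1`
  have hR : ((m * l : ℤ) : ℚ) * x + x ^ 3 + 8 * m * x ^ 2 ≠ 0 ∧
      padicValRat 2 (((m * l : ℤ) : ℚ) * x + x ^ 3 + 8 * m * x ^ 2) = 1 := by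
    have hmain : padicValRat 2 (((m * l : ℤ) : ℚ) * x) = 1 := by
      rw [padicValRat.mul hml0 hx0, hvml, hv]; rfl
    rw [← hmain]
    refine padicValRat_add_add_eq (mul_ne_zero hml0 hx0) (Or.inr ?_) ?_
    · rw [hmain, padicValRat.pow, hv]; norm_num
    · by_cases hm0 : (m : ℚ) = 0
      · exact Or.inl (by rw [hm0]; ring)
      · refine Or.inr ?_
        have h8 : (8 : ℚ) * m * x ^ 2 = ((8 * m : ℤ) : ℚ) * x ^ 2 := by push_cast; ring
        rw [hmain, h8, padicValRat.mul (by exact_mod_cast (show (8 * m : ℚ) ≠ 0 by positivity))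
          (pow_ne_zero 2 hx0), padicValRat.pow, hv]
        have := padicValRat_intCast_nonneg (p := 2) (8 * m)
        omega
  have hRHS : x ^ 3 + 8 * (m : ℚ) * x ^ 2 + m * l * x =
      ((m * l : ℤ) : ℚ) * x + x ^ 3 + 8 * m * x ^ 2 := by push_cast; ring
  have hLHS : y ^ 2 + x * y = y * (y + x) := by ring
  rw [hRHS, hLHS] at h
  have hy0 : y ≠ 0 := by
    rintro rfl
    rw [zero_mul] at h
    exact hR.1 h.symm
  have hyx : y + x ≠ 0 := by
    intro h0
    rw [h0, mul_zero] at h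
    exact hR.1 h.symm
  have hval := congrArg (padicValRat 2) h
  rw [padicValRat.mul hy0 hyx, hR.2] at hval
  by_cases hw : padicValRat 2 y < 1
  · rw [(padicValRat_add_eq_left (p := 2) hy0 (Or.inr (by omega))).2] at hval
    omega
  · have h1 : (1 : ℤ) ≤ padicValRat 2 (y + x) :=
      (le_padicValRat_add_or (p := 2) (Or.inr (by omega)) (Or.inr hv.ge)).resolve_left hyx
    omega

end IntegralPoints

section LocalParities

variable {p : ℕ} [Fact p.Prime]

/-- Parity of a product which is a square: if `z² = d₁ d₂ d₃` with all `dᵢ ≠ 0` then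
`v_p(d₁) + v_p(d₂) + v_p(d₃)` is even. [folklore] -/
theorem even_sum_padicValRat_of_sq {d₁ d₂ d₃ z : ℚ} (h : z ^ 2 = d₁ * d₂ * d₃) (h₁ : d₁ ≠ 0)
    (h₂ : d₂ ≠ 0) (h₃ : d₃ ≠ 0) :
    Even (padicValRat p d₁ + padicValRat p d₂ + padicValRat p d₃) := by
  have hv := congrArg (padicValRat p) h
  rw [padicValRat.pow, padicValRat.mul (mul_ne_zero h₁ h₂) h₃, padicValRat.mul h₁ h₂] at hv
  exact ⟨padicValRat p z, by omega⟩

/-- The `2`-division form of Kramer's curve `A` (11): on `y² + xy = x³ + 8m x² + m(16m+1)x`,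
`(y + x/2)² = x (x + 4m) (x + (16m+1)/4)`, i.e. `e₁ = 0`, `e₂ = -4m`, `e₃ = -(16m+1)/4`
(Kramer §4: `t₁ = 0`, `t₂ = 4m`, `t₃ = (b₂ - 16m)/4`). [cite: Kramer1983, §4 (model (5))] -/
theorem sq_eq_descentTriple {m x y : ℚ}
    (h : y ^ 2 + x * y = x ^ 3 + 8 * m * x ^ 2 + m * (16 * m + 1) * x) :
    (y + x / 2) ^ 2 = x * (x + 4 * m) * (x + (16 * m + 1) / 4) := by
  linear_combination h

/-- Valuation of `4m` at `2` for odd `m`: `v₂(4m) = 2`. [folklore] -/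
theorem padicValRat_two_four_mul {m : ℤ} (hm : Odd m) : padicValRat 2 (4 * (m : ℚ)) = 2 := by
  have hm0 : (m : ℚ) ≠ 0 := by
    obtain ⟨k, rfl⟩ := hm
    exact_mod_cast (show (2 * k + 1 : ℤ) ≠ 0 by omega)
  have hm2 : ¬ (2 : ℤ) ∣ m := by rw [← even_iff_two_dvd]; exact Int.not_even_iff_odd.mpr hm
  rw [padicValRat.mul (by norm_num) hm0, padicValRat_intCast_eq_zero (p := 2) (by exact_mod_cast hm2),
    show (4 : ℚ) = ((2 : ℕ) : ℚ) ^ 2 by norm_num, padicValRat.pow, padicValRat.self (by norm_num)]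
  norm_num

/-- Valuation of `(16m+1)/4` at `2`: `v₂ = -2`. [folklore] -/
theorem padicValRat_two_l_div_four (m : ℤ) : padicValRat 2 ((16 * (m : ℚ) + 1) / 4) = -2 := by
  have hl : (16 * (m : ℚ) + 1) = ((16 * m + 1 : ℤ) : ℚ) := by push_cast; ring
  have hl0 : ((16 * m + 1 : ℤ) : ℚ) ≠ 0 := by exact_mod_cast (show (16 * m + 1 : ℤ) ≠ 0 by omega)
  have hl2 : ¬ (2 : ℤ) ∣ 16 * m + 1 := by omega
  rw [hl, padicValRat.div hl0 (by norm_num), padicValRat_intCast_eq_zero (p := 2) (by exact_mod_cast hl2),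
    show (4 : ℚ) = ((2 : ℕ) : ℚ) ^ 2 by norm_num, padicValRat.pow, padicValRat.self (by norm_num)]
  norm_num

/-- **Kramer's Lemma 2 (ii), containment half, parities**: for `m` odd and a rational point
`(x, y)` of `A` with `x ∉ {0, -4m, -(16m+1)/4}`, the three descent coordinates
`x`, `x + 4m`, `x + (16m+1)/4` all have EVEN `2`-adic valuation (`T₂ ⊆` units × squares).
Elementary proof by the case analysis `v₂(x) < 0` (even, `even_padicValRat_of_neg`),
`v₂(x) = 0`, `v₂(x) = 1` (impossible, `padicValRat_two_x_ne_one`), `v₂(x) ≥ 2`.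
[cite: Kramer1983, Lemma 2 (ii)] -/
theorem even_padicValRat_two {m : ℤ} (hm : Odd m) {x y : ℚ}
    (h : y ^ 2 + x * y = x ^ 3 + 8 * m * x ^ 2 + m * (16 * m + 1) * x)
    (h₁ : x ≠ 0) (h₂ : x + 4 * m ≠ 0) (h₃ : x + (16 * m + 1) / 4 ≠ 0) :
    Even (padicValRat 2 x) ∧ Even (padicValRat 2 (x + 4 * m)) ∧
      Even (padicValRat 2 (x + (16 * m + 1) / 4)) := by
  have hsum := even_sum_padicValRat_of_sq (p := 2) (sq_eq_descentTriple h) h₁ h₂ h₃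
  have h4m := padicValRat_two_four_mul hm
  have hl4 := padicValRat_two_l_div_four m
  have hm0 : (4 * m : ℚ) ≠ 0 := by intro h0; rw [h0] at h4m; simp at h4m
  have hl0 : ((16 * (m : ℚ) + 1) / 4) ≠ 0 := by intro h0; rw [h0] at hl4; simp at hl4
  have hne1 : padicValRat 2 x ≠ 1 :=
    padicValRat_two_x_ne_one (l := 16 * m + 1) (y := y) hm (by
      rw [Int.odd_iff]; omega) (by push_cast; linear_combination h)
  set v := padicValRat 2 x with hv
  rcases lt_trichotomy v 0 with hneg | hzero | hpos
  · -- `v < 0`, even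
    have heven : Even v := even_padicValRat_of_neg (p := 2) (a₁ := 1) (a₂ := 8 * m) (a₃ := 0)
      (a₄ := m * (16 * m + 1)) (a₆ := 0) (x := x) (y := y) (by push_cast; linear_combination h) hneg
    have hv2 : padicValRat 2 (x + 4 * m) = v :=
      (padicValRat_add_eq_left (p := 2) h₁ (Or.inr (by rw [h4m]; omega))).2
    rcases (show v = -2 ∨ v ≤ -3 by obtain ⟨k, hk⟩ := heven; omega) with h2 | h3
    · refine ⟨heven, by rw [hv2]; exact heven, ?_⟩
      rw [hv2] at hsum
      obtain ⟨k, hk⟩ := heven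
      obtain ⟨k', hk'⟩ := hsum
      exact ⟨k' - 2 * k, by omega⟩
    · have hv3 : padicValRat 2 (x + (16 * m + 1) / 4) = v :=
        (padicValRat_add_eq_left (p := 2) h₁ (Or.inr (by rw [hl4]; omega))).2
      exact ⟨heven, by rw [hv2]; exact heven, by rw [hv3]; exact heven⟩
  · -- `v = 0`
    have hv3 : padicValRat 2 (x + (16 * m + 1) / 4) = -2 := by
      rw [add_comm]
      rw [← hl4]
      exact (padicValRat_add_eq_left (p := 2) hl0 (Or.inr (by rw [hl4]; omega))).2
    refine ⟨⟨0, by omega⟩, ?_, ⟨-1, by rw [hv3]; norm_num⟩⟩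
    rw [hv3] at hsum
    obtain ⟨k, hk⟩ := hsum
    exact ⟨k + 1, by omega⟩
  · -- `v ≥ 2`
    have hv2' : 2 ≤ v := by omega
    have hv3 : padicValRat 2 (x + (16 * m + 1) / 4) = -2 := by
      rw [add_comm, ← hl4]
      exact (padicValRat_add_eq_left (p := 2) hl0 (Or.inr (by rw [hl4]; omega))).2
    rw [hv3] at hsum
    rcases (show v = 2 ∨ 3 ≤ v by omega) with h2 | h3
    · refine ⟨⟨1, by omega⟩, ?_, ⟨-1, by rw [hv3]; norm_num⟩⟩
      obtain ⟨k, hk⟩ := hsum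
      exact ⟨k, by omega⟩
    · have hv2 : padicValRat 2 (x + 4 * m) = 2 := by
        rw [add_comm, ← h4m]
        exact (padicValRat_add_eq_left (p := 2) hm0 (Or.inr (by rw [h4m]; omega))).2
      rw [hv2] at hsum
      refine ⟨?_, ⟨1, by rw [hv2]; norm_num⟩, ⟨-1, by rw [hv3]; norm_num⟩⟩
      obtain ⟨k, hk⟩ := hsum
      exact ⟨k, by omega⟩

/-- **Kramer's Lemma 2 (i), containment half**: at an odd prime `p ∤ m(16m+1)` (good
reduction), the three descent coordinates of a rational point with
`x ∉ {0, -4m, -(16m+1)/4}` have even valuation (`T_p ⊆` units × squares) — the differences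
`4m`, `(16m+1)/4`, `1/4` of the `eᵢ` being `p`-units. (The tree's
`Valuation.two_dvd_log_map_sub_of_sq_eq` is the same statement for abstract valuations.)
[cite: Kramer1983, Lemma 2 (i)] -/
theorem even_padicValRat_odd_good {m : ℤ} (hp2 : p ≠ 2) (hpm : ¬ (p : ℤ) ∣ m)
    (hpl : ¬ (p : ℤ) ∣ 16 * m + 1) {x y : ℚ}
    (h : y ^ 2 + x * y = x ^ 3 + 8 * m * x ^ 2 + m * (16 * m + 1) * x)
    (h₁ : x ≠ 0) (h₂ : x + 4 * m ≠ 0) (h₃ : x + (16 * m + 1) / 4 ≠ 0) :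
    Even (padicValRat p x) ∧ Even (padicValRat p (x + 4 * m)) ∧
      Even (padicValRat p (x + (16 * m + 1) / 4)) := by
  have hsum := even_sum_padicValRat_of_sq (p := p) (sq_eq_descentTriple h) h₁ h₂ h₃
  have hp4 : ¬ (p : ℤ) ∣ 4 := by
    have h4 : ¬ p ∣ 4 := fun h4 =>
      hp2 ((Nat.prime_dvd_prime_iff_eq Fact.out Nat.prime_two).mp
        (Nat.Prime.dvd_of_dvd_pow Fact.out (show p ∣ 2 ^ 2 from h4)))
    exact_mod_cast h4
  have hv4 : padicValRat p (4 : ℚ) = 0 := by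
    have h4 := padicValRat_intCast_eq_zero (p := p) hp4
    rwa [show ((4 : ℤ) : ℚ) = 4 by norm_num] at h4
  have hm0 : (m : ℚ) ≠ 0 := by exact_mod_cast (show m ≠ 0 from fun h0 => hpm (h0 ▸ dvd_zero _))
  have h4m0 : (4 * m : ℚ) ≠ 0 := by positivity
  have hv4m : padicValRat p (4 * (m : ℚ)) = 0 := by
    rw [padicValRat.mul (by norm_num) hm0, hv4, padicValRat_intCast_eq_zero (p := p) hpm]; rfl
  have hl : (16 * (m : ℚ) + 1) / 4 = ((16 * m + 1 : ℤ) : ℚ) / 4 := by push_cast; ring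
  have hl0 : (16 * (m : ℚ) + 1) / 4 ≠ 0 := by
    rw [hl]; exact div_ne_zero (by exact_mod_cast (show (16 * m + 1 : ℤ) ≠ 0 by omega)) (by norm_num)
  have hvl : padicValRat p ((16 * (m : ℚ) + 1) / 4) = 0 := by
    rw [hl, padicValRat.div (by exact_mod_cast (show (16 * m + 1 : ℤ) ≠ 0 by omega)) (by norm_num),
      padicValRat_intCast_eq_zero (p := p) hpl, hv4]; rfl
  have hvq : padicValRat p ((1 : ℚ) / 4) = 0 := by
    rw [padicValRat.div one_ne_zero (by norm_num), hv4, padicValRat.one]; rfl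
  set v := padicValRat p x with hv
  rcases lt_trichotomy v 0 with hneg | hzero | hpos
  · have hv2 : padicValRat p (x + 4 * m) = v :=
      (padicValRat_add_eq_left (p := p) h₁ (Or.inr (by rw [hv4m]; omega))).2
    have hv3 : padicValRat p (x + (16 * m + 1) / 4) = v :=
      (padicValRat_add_eq_left (p := p) h₁ (Or.inr (by rw [hvl]; omega))).2
    rw [hv2, hv3] at hsum
    have heven : Even v := by obtain ⟨k, hk⟩ := hsum; exact ⟨k - v, by omega⟩
    exact ⟨heven, by rw [hv2]; exact heven, by rw [hv3]; exact heven⟩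
  · by_cases hv2 : padicValRat p (x + 4 * m) = 0
    · rw [hv2, hzero] at hsum
      exact ⟨⟨0, by omega⟩, ⟨0, by rw [hv2]; rfl⟩, by simpa using hsum⟩
    · have hge : (0 : ℤ) ≤ padicValRat p (x + 4 * m) :=
        (le_padicValRat_add_or (p := p) (Or.inr hzero.symm.le) (Or.inr hv4m.symm.le)).resolve_left h₂
      have hpos2 : 0 < padicValRat p (x + 4 * m) := lt_of_le_of_ne hge (Ne.symm hv2)
      have hv3 : padicValRat p (x + (16 * m + 1) / 4) = 0 := by
        have : x + (16 * (m : ℚ) + 1) / 4 = 1 / 4 + (x + 4 * m) := by ring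
        rw [this, ← hvq]
        exact (padicValRat_add_eq_left (p := p) (by norm_num) (Or.inr (by rw [hvq]; exact hpos2))).2
      rw [hv3, hzero] at hsum
      exact ⟨⟨0, by omega⟩, by simpa using hsum, ⟨0, by rw [hv3]; rfl⟩⟩
  · have hv2 : padicValRat p (x + 4 * m) = 0 := by
      rw [add_comm, ← hv4m]
      exact (padicValRat_add_eq_left (p := p) h4m0 (Or.inr (by rw [hv4m]; exact hpos))).2
    have hv3 : padicValRat p (x + (16 * m + 1) / 4) = 0 := by
      rw [add_comm, ← hvl]
      exact (padicValRat_add_eq_left (p := p) hl0 (Or.inr (by rw [hvl]; exact hpos))).2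
    rw [hv2, hv3] at hsum
    exact ⟨by simpa using hsum, ⟨0, by rw [hv2]; rfl⟩, ⟨0, by rw [hv3]; rfl⟩⟩

end LocalParities

end Literature.NumberTheory.EllipticCurves.KramerTwoDescent
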